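import Summits.Ventures.QEC.Census.GB.GB126b.BZKernelZ1
import Summits.Ventures.QEC.Census.GB.GB126b.BZKernelZ2
import Summits.Ventures.QEC.Census.GB.GB126b.BZKernelZ3
import Summits.Ventures.QEC.Census.GB.GB126b.BZKernelZ4
import Summits.Ventures.QEC.Census.GB.GB126b.BZKernelZ5
import Summits.Ventures.QEC.Census.GB.GB126b.BZKernelZ6
import Summits.Ventures.QEC.Census.CertCheckBZSound
import Summits.Ventures.QEC.Census.CertChunks
import HarnessLib

/-!
# `GB126b` — `bz` certificate, side Z: structure + `d_Z = 10` from the 6 block files at tier KERNEL (compact row; lane engine δ for the enumeration)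

the weight-6 generalized-bicycle code [[126,12,10]] (A = 1+x⁴³+x³⁷, B = 1+x⁵⁹+x³¹, ℓ = 63; BCGMRY24 Methods quoting PK21 App. C; lit-3 Q2-TARGETS row GB126b, cell B.2)
Structural check / row counts / information sets / bounds = the Bool words of `Census/CertCheckBZ.lean` and
`Census/CertBZInfoSets.lean` by `decide +kernel`; enumeration verdicts by the lane-parallel replay
(`Census/CertBZPlane*.lean`, `Plane.reaches_of_segList` + `DistCert.bzZEnum_of_reaches`/`bzXEnum_of_reaches`); blocks by
`DistCert.bzZBlock_of_parts`; the distance by `DistCert.dZ_code_of_bz` / `dX_code_of_bz` (`Census/CertCheckBZSound.lean`).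
Decl names = the row-by-row lane's (qec-search-7 / qec-search-4 emitters); data literals in `Cert.lean` / `BZData*.lean`
are those emitters' output verbatim. Axioms standard; `Elab.async false` (gate memory guard). Emitted by
HOME/lean/type-01/kdelta/emit_compact_row.py (qec-type-01).
-/

set_option autoImplicit false
set_option Elab.async false

namespace Summit.Ventures.QEC.Census.GB126b

open Summit.Ventures.QEC.Census

/-- Structural part of side Z of the `bz` certificate of `GB126b` (rank certificates, pairing, dimension, word sizes, parity, label cover; kernel `decide`). -/
theorem bzZStruct_ok : GB126b.cert.bzZStruct GB126b.bzData = true := by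
  decide +kernel

/-- Row-count check of side Z (`kb = |G_b|` for every matrix; kernel `decide`). -/
theorem bzZLen_ok : GB126b.cert.bzZLen GB126b.bzData = true := by
  decide +kernel

set_option maxRecDepth 100000 in
/-- **`d_Z = 10` for `GB126b`** (tier KERNEL): the CSS code of the certificate has Z-distance exactly 10 (`DistCert.dZ_code_of_bz` over the structural check, the row counts and every block). -/
theorem dZ_eq_bz : (GB126b.cert.code (GB126b.cert.commOK_of_checkStructure (by decide +kernel))).dZ = 10 :=
  GB126b.cert.dZ_code_of_bz GB126b.bzData (by decide +kernel) bzZStruct_ok bzZLen_ok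
    (forall_lt_append (forall_lt_append (forall_lt_append (forall_lt_append (forall_lt_append (forall_lt_append (forall_lt_append (forall_lt_append (forall_lt_append (forall_lt_append (forall_lt_append (forall_lt_append (forall_lt_append (forall_lt_append (forall_lt_append (forall_lt_append (forall_lt_append (forall_lt_append (forall_lt_append (forall_lt_append (forall_lt_append (forall_lt_append (forall_lt_append (forall_lt_append (forall_lt_append (forall_lt_append (forall_lt_append (forall_lt_append (forall_lt_append (forall_lt_append (forall_lt_append (forall_lt_append (forall_lt_append (forall_lt_append (forall_lt_append (forall_lt_append (forall_lt_append (forall_lt_append (forall_lt_append (forall_lt_append (forall_lt_append (forall_lt_append (forall_lt_append (forall_lt_append (forall_lt_append (forall_lt_append (forall_lt_append (forall_lt_append (forall_lt_append (forall_lt_append (forall_lt_append (forall_lt_append (forall_lt_append (forall_lt_append (forall_lt_append (forall_lt_append (forall_lt_append (forall_lt_append (forall_lt_append (forall_lt_append (forall_lt_append (forall_lt_append (forall_lt_append (forall_lt_append (forall_lt_append (forall_lt_zero) (forall_lt_single 0 blkZ_0)) (forall_lt_single 1 blkZ_1)) (forall_lt_single 2 blkZ_2)) (forall_lt_single 3 blkZ_3))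 (forall_lt_single 4 blkZ_4)) (forall_lt_single 5 blkZ_5)) (forall_lt_single 6 blkZ_6)) (forall_lt_single 7 blkZ_7)) (forall_lt_single 8 blkZ_8)) (forall_lt_single 9 blkZ_9)) (forall_lt_single 10 blkZ_10)) (forall_lt_single 11 blkZ_11)) (forall_lt_single 12 blkZ_12)) (forall_lt_single 13 blkZ_13)) (forall_lt_single 14 blkZ_14)) (forall_lt_single 15 blkZ_15)) (forall_lt_single 16 blkZ_16)) (forall_lt_single 17 blkZ_17)) (forall_lt_single 18 blkZ_18)) (forall_lt_single 19 blkZ_19)) (forall_lt_single 20 blkZ_20)) (forall_lt_single 21 blkZ_21)) (forall_lt_single 22 blkZ_22)) (forall_lt_single 23 blkZ_23)) (forall_lt_single 24 blkZ_24)) (forall_lt_single 25 blkZ_25)) (forall_lt_single 26 blkZ_26)) (forall_lt_single 27 blkZ_27)) (forall_lt_single 28 blkZ_28)) (forall_lt_single 29 blkZ_29)) (forall_lt_single 30 blkZ_30)) (forall_lt_single 31 blkZ_31)) (forall_lt_single 32 blkZ_32)) (forall_lt_single 33 blkZ_33)) (forall_lt_single 34 blkZ_34)) (forall_lt_single 35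 blkZ_35)) (forall_lt_single 36 blkZ_36)) (forall_lt_single 37 blkZ_37)) (forall_lt_single 38 blkZ_38)) (forall_lt_single 39 blkZ_39)) (forall_lt_single 40 blkZ_40)) (forall_lt_single 41 blkZ_41)) (forall_lt_single 42 blkZ_42)) (forall_lt_single 43 blkZ_43)) (forall_lt_single 44 blkZ_44)) (forall_lt_single 45 blkZ_45)) (forall_lt_single 46 blkZ_46)) (forall_lt_single 47 blkZ_47)) (forall_lt_single 48 blkZ_48)) (forall_lt_single 49 blkZ_49)) (forall_lt_single 50 blkZ_50)) (forall_lt_single 51 blkZ_51)) (forall_lt_single 52 blkZ_52)) (forall_lt_single 53 blkZ_53)) (forall_lt_single 54 blkZ_54)) (forall_lt_single 55 blkZ_55)) (forall_lt_single 56 blkZ_56)) (forall_lt_single 57 blkZ_57)) (forall_lt_single 58 blkZ_58)) (forall_lt_single 59 blkZ_59)) (forall_lt_single 60 blkZ_60)) (forall_lt_single 61 blkZ_61)) (forall_lt_single 62 blkZ_62)) (forall_lt_single 63 blkZ_63)) (forall_lt_single 64 blkZ_64))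

end Summit.Ventures.QEC.Census.GB126b
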